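import Summits.QuantumFields.YangMills.Theorems.BalabanUVNodesN15AtRateRecord12
import Summits.QuantumFields.YangMills.Theorems.BalabanUVNodesN15AtSpineCarriersV1
import Summits.QuantumFields.YangMills.Theorems.BalabanUVNodesN15AtSpineCarriersV1Gauge
import Summits.QuantumFields.YangMills.Theorems.BalabanUVNodesRateReadingOfRecord12

/-!
# YM-DAG node N15 (= NE2) AT THE STAGE-12 RATE-RECORD HOME AND AT THE READING OF RECORD (EDITION 1) FOR dag-n15-c's TWO `V′₁(A)`-LIVE
# VECTOR-PIECE FAMILIES (fields `(A⁺, A⁻, W)` carried independently ∕ the gauge field `A′` itself as the datum) — the K4 stub `S_N15 (RRec₁₂ 𝔯)` ∕ `S_N15 (RRec₁₂ (readingOfRecord₁₂ w1 ℓ₃ ne2 ne1))` when the reading's NE2 objects ARE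
# the realised `V′₁` carriers: OPERATOR layer by the producer's theorem (background LIVE, (3.35) consumed), SITE and UNIT layers displayed

Track A of `YM-PLAN.md` (cell `pub-ymgap`, HUMAN RULING D-0062), node **N15** [NE2: η-rate, linear theory — LG-vector + background layers NEW;
scalar layer PRINTED + KERNEL, [King1986] Lemma 4.5 (4.38) p. 674]; seat `pub-ymgap-dag-n15-a` (generation g10, KNIT-BY-NAME), part 32 of the
lineage.  Written on the producer's word (pub-ymgap INBOX, dag-n15-c g3 LANDED-3∕4, 2026-08-27T00:41:47Z: «cc dag-n15-a (a `…AtRateRecord12`-style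
face for the V′₁ family is yours if wanted: producer `VectorPiece.ne2PlusOperator_vectorPiece_v1`)»).  Kernel bookkeeping: 0 `def`, 0 `sorry`,
standard axioms; COUNT-NEUTRAL; `--supports` the K3′ item `SpineGivenEndpointR12` (stmt-QuantumFields-19908, helper).

CONSUMED BY NAME (nothing restated): dag-n15-c's spine-carrier closers `N15AtSpineCarriers.s_N15_of_v1Reading` (p479193; producer
`VectorPiece.ne2PlusOperator_vectorPiece_v1`, p478944: `T4EtaRate.NE2PlusOperator` for the `U = 1` vector single-scale piece ⊗ 1_𝔤 dressed by the
print's own first-order species `V′₁(A)` of [B9] (3.52), all three terms, both bond orientations, the three coefficient fields `(A⁺, A⁻, W)` carried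
independently, with (3.35) CONSUMED and the size guard LIVE) and `N15AtSpineCarriers.s_N15_of_v1GReading` (p483163; producer
`VectorPiece.ne2PlusOperator_vectorPiece_v1G`, p482853: the same with the GAUGE FIELD `A′` ITSELF as the datum — (3.35) = the printed C² pair
(3.35)–(3.36) read at the unit scale, the derived triple `v1fieldsOfGauge` by `BackgroundLayer.reg335_fields_of_gauge`);
this seat's keyed-home lemma `AtKeyedHome.s_N15_of_admits` (p465385) and Stage-12 certificate `AtRateRecord12.admits_rRec₁₂_ne2` (p466641);
dag-n22-e's layer B ₁₂ (`RateReading₁₂`, `RRec₁₂`, p466281) and reading of record, edition 1 (`readingOfRecord₁₂ w1 ℓ₃ ne2 ne1` with its `rfl`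
face `readingOfRecord₁₂_ne2` and `readingOfRecord₁₂_populated_iff`, p469629); RR-1's display `Node00.NE2Objects₁₁.Populated` (p461303); this
seat's `VectorPiece.vecIndexS_nonempty` (p448474).

WHAT THIS MODULE IS.
* §1 ANY KEYED HOME: `s_N15_of_admits_v1` — if the home admits only the literals of a key-indexed NE2 reading and every literal IS the `V′₁` carriers
  (index `VectorPiece.VecIndexS d L`, instances `v1VecInstance 𝔄 ι L hL`, kernels `v1VecFamily4 𝔄 ι e L hL`, any `c35 > 0`, `p`, site ∕ unit kernels,
  region, unit distance) together with the SITE and UNIT layers on them, then `S_N15 RRec` — the operator conjunct is NOT a hypothesis.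
* §2 THE STAGE-12 HOME: `s_N15_rRec₁₂_of_v1` (§1 at the certificate `admits_rRec₁₂_ne2`); `populated_v1Objects` (RR-1's display HOLDS at every `V′₁`
  literal: `VecIndexS d L` is inhabited).
* §3 THE READING OF RECORD, EDITION 1 (N15's layer is its RESIDUAL parameter `ne2`): `s_N15_readingOfRecord₁₂_of_v1` — for every residual layer
  `ne2` whose values are `V′₁` literals carrying the two displayed layers, `S_N15 (RRec₁₂ (readingOfRecord₁₂ w1 ℓ₃ ne2 ne1))`;
  `populated_readingOfRecord₁₂_of_v1` — such a reading of record is `Populated` at every Stage-12 parameter (n22-e's `readingOfRecord₁₂_populated_iff`: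
  the display's last third met); `s_N15_readingOfRecord₁₂_v1Const` ∕ `populated_readingOfRecord₁₂_v1Const` — the CONSTANT residual layer at one
  `V′₁` literal: the N15 slot of K3′'s rate side at the reading of record, populated, with a background-LIVE operator layer by name and exactly the
  site and unit layers owed.
* §4 THE SAME FOR THE GAUGE-FIELD-AS-DATUM FAMILY (`v1GVecInstance 𝔄 ι L hL`, `v1GVecFamily4 𝔄 ι e L hL`): `s_N15_of_admits_v1G`, `s_N15_rRec₁₂_of_v1G`,
  `populated_v1GObjects`, `s_N15_readingOfRecord₁₂_of_v1G`, `s_N15_readingOfRecord₁₂_v1GConst`, `populated_readingOfRecord₁₂_v1GConst`.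

HONEST FRAMING.  Kernel bookkeeping BY NAME; no estimate is proved here.  What enters hypothesis-free (through dag-n15-c's theorems) is the OPERATOR
layer of the LINEAR (`U = 1`) vector single-scale piece of [B5]∕[B6]∕King (4.42) tensored with `1_𝔤` and dressed by the print's first-order species
`V′₁(A)` — §1–§3: the three coefficient fields transported independently by fibrewise means; §4: one gauge field `A′` transported by its fibrewise mean,
the coarse triple being the mean of the fine triple (linearised (C3), n15-c's stated scope) — NOT the (C3) nonlinear transport, NOT
`F′_{1,k}`, NOT `V′₂` of (3.55)–(3.62), NOT NODE 00's multiscale carrier, NOT Bałaban's `G(U)`; the SITE-KERNEL and UNIT-LATTICE layers stay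
DISPLAYED (no producer with the background live exists in the tree); the residual layer `ne2` of the reading of record is NOT pinned by NODE 00 (the
choices in §3 are readings this file NAMES, not the objects of record).  NE2⁺ is NOT PRINTED beyond King's scalar template and NOT PROVED; no datum
key is claimed inhabited (K0″ open); **N15 ∕ NE2 is NOT discharged** (typed 28∕28, discharged 5∕27 · A 5∕28 UNMOVED); count-neutral; one finite
four-torus programme at fixed `ε` — NOT ℝ⁴, NOT infinite volume, NOT OS, NOT a mass gap, NOT Clay.  Restate-immune (no Theses import, no `Record12`
decl read).  No decl below carries a cite tag.
-/

set_option autoImplicit false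

noncomputable section

namespace Summit.QuantumFields.YangMills.BalabanUVNodes.N15.AtRateRecord12V1

open Literature.MathematicalPhysics.QuantumFieldTheory.Balaban1983to89
open Literature.MathematicalPhysics.QuantumFieldTheory.Balaban1983to89.T4Continuum (T4Family ULoop)
open Literature.MathematicalPhysics.QuantumFieldTheory.Balaban1983to89.T4EtaRate (PairedInstance NE2PlusOperator NE2PlusSite NE2PlusUnit)
open Node00 (IsDatumOfRecord₁₂C Stage12Params NE2Objects₁₁ NE3Letters₁₁)
open Node00.W1 (ReadingData)
open Summit.QuantumFields.YangMills.Theorems.N15AtSpineCarriers (s_N15_of_v1Reading s_N15_of_v1GReading)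
open Summit.QuantumFields.YangMills.BalabanUVNodes.N15.VectorPiece (VecIndexS vecIndexS_nonempty v1VecInstance v1VecFamily4 v1GVecInstance
  v1GVecFamily4)
open Summit.QuantumFields.YangMills.BalabanUVNodes.N15.AtKeyedHome (s_N15_of_admits)
open Summit.QuantumFields.YangMills.BalabanUVNodes.N15.AtRateRecord12 (admits_rRec₁₂_ne2)
open YMDAG.UVSplit (Datum NE1pCarriers NE2Carriers RateCarriers RateRecordPred N15At S_N15 ne2OfRecord₁₁ RateReading₁₂ RRec₁₂
  readingOfRecord₁₂ readingOfRecord₁₂_ne2 readingOfRecord₁₂_populated_iff)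

variable {N : ℕ} [NeZero N] {d : ℕ} {L : ℕ} [NeZero L] {ι : Type} [Fintype ι] [DecidableEq ι]
  {𝔄 : Type} [NormedRing 𝔄] [NormedAlgebra ℝ 𝔄] [CompleteSpace 𝔄] (e : 𝔄 ≃L[ℝ] (ι → ℝ))

/-! ## §1 Any keyed home: the `V′₁` literals with the two displayed layers close the stub -/

section KeyedHome

variable {key : (F : T4Family) → Datum F N → Prop}
  (ne2At : ∀ {F : T4Family} {D : Datum F N}, key F D → (ℕ → ℝ) → List (ULoop F) → ℕ → NE2Objects₁₁)
  (RRec : RateRecordPred N)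

/-- **THE `V′₁(A)`-LIVE OPERATOR LAYER AT ANY KEYED HOME.**  For `d + 1 ≥ 2`, `L ≥ 1`, coordinates `e : 𝔄 ≃L[ℝ] ℝ^ι`: if the home admits only the
literals of the key-indexed reading `ne2At` (`hadm`) and at every key, `(g₀, os)` and run length the reading's NE2 objects ARE dag-n15-c's `V′₁`
carriers — index `VecIndexS d L`, paired instances `VectorPiece.v1VecInstance 𝔄 ι L hL` (configurations `(A⁺, A⁻, W)`, (3.35) = the letter pair on each
field, guard = the index's own `M`, LIVE), operator kernels `VectorPiece.v1VecFamily4 𝔄 ι e L hL` (V2's constructed pair fed with the -a pieces ⊗ 1_𝔤,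
forward and backward derived pieces), any `c35 > 0`, `p`, site ∕ unit kernels, region, unit distance — together with the SITE and UNIT layers on them,
then `S_N15 RRec`: the operator conjunct is the producer's `VectorPiece.ne2PlusOperator_vectorPiece_v1` (through
`N15AtSpineCarriers.s_N15_of_v1Reading RRec`), NOT a hypothesis.  Honest scope: the LINEAR vector piece dressed by the linearised first-order
species — NOT Bałaban's `G(U)`. [bookkeeping] -/
theorem s_N15_of_admits_v1 (hd : 1 ≤ d) (hL : 1 ≤ L)
    (hadm : ∀ (F : T4Family) (D : Datum F N) (g₀ : ℕ → ℝ) (os : List (ULoop F)) (R : RateCarriers N), RRec F D g₀ os R →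
      ∃ (h : key F D) (k : ℕ), R.ne2 = ne2OfRecord₁₁ (ne2At h g₀ os k))
    (h : ∀ (F : T4Family) (D : Datum F N) (hk : key F D) (g₀ : ℕ → ℝ) (os : List (ULoop F)) (k : ℕ),
      ∃ (c35 p : ℝ) (Ksite Kunit : ∀ j : VecIndexS d L, B9.SiteKernel (v1VecInstance (d := d) 𝔄 ι L hL j).gc (v1VecInstance (d := d) 𝔄 ι L hL j).Bf)
        (inΛ : ∀ j : VecIndexS d L, (v1VecInstance (d := d) 𝔄 ι L hL j).gc.Site → Prop)
        (unitDist : ∀ j : VecIndexS d L, (v1VecInstance (d := d) 𝔄 ι L hL j).gc.Site → (v1VecInstance (d := d) 𝔄 ι L hL j).gc.Site → ℝ),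
        0 < c35 ∧
        ne2At hk g₀ os k =
          { I := VecIndexS d L, c35 := c35, p := p, pi := v1VecInstance (d := d) 𝔄 ι L hL, Kop := v1VecFamily4 (d := d) 𝔄 ι e L hL,
            Ksite := Ksite, Kunit := Kunit, inΛ := inΛ, unitDist := unitDist } ∧
        NE2PlusSite 4 p c35 (v1VecInstance (d := d) 𝔄 ι L hL) Ksite ∧ NE2PlusUnit c35 (v1VecInstance (d := d) 𝔄 ι L hL) Kunit inΛ unitDist) :
    S_N15 RRec := by
  refine s_N15_of_v1Reading e hd hL RRec ?_
  intro F D g₀ os R hR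
  obtain ⟨hk, k, hne2⟩ := hadm F D g₀ os R hR
  obtain ⟨c35, p, Ksite, Kunit, inΛ, unitDist, hc35, hlit, hsite, hunit⟩ := h F D hk g₀ os k
  refine ⟨c35, p, Ksite, Kunit, inΛ, unitDist, hc35, ?_, hsite, hunit⟩
  rw [hne2, hlit]
  rfl

end KeyedHome

/-! ## §2 The Stage-12 home `RRec₁₂ 𝔯` -/

/-- **THE `V′₁(A)`-LIVE OPERATOR LAYER AT THE STAGE-12 HOME.**  For `d + 1 ≥ 2`, `L ≥ 1`: if at every family, every Stage-12 datum of record (key `hD`),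
every `(g₀, os)` and every run length the reading's NE2 objects `(𝔯.lit F hD.params hD.provisos g₀ os).ne2 k` ARE the `V′₁` carriers together with the
SITE and UNIT layers on them, then `S_N15 (RRec₁₂ 𝔯)` (§1 at the certificate `AtRateRecord12.admits_rRec₁₂_ne2`); the operator conjunct is dag-n15-c's
theorem, NOT a hypothesis. [bookkeeping] -/
theorem s_N15_rRec₁₂_of_v1 (hd : 1 ≤ d) (hL : 1 ≤ L) (𝔯 : RateReading₁₂ N)
    (h : ∀ (F : T4Family) (D : Datum F N) (hD : IsDatumOfRecord₁₂C F N D) (g₀ : ℕ → ℝ) (os : List (ULoop F)) (k : ℕ),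
      ∃ (c35 p : ℝ) (Ksite Kunit : ∀ j : VecIndexS d L, B9.SiteKernel (v1VecInstance (d := d) 𝔄 ι L hL j).gc (v1VecInstance (d := d) 𝔄 ι L hL j).Bf)
        (inΛ : ∀ j : VecIndexS d L, (v1VecInstance (d := d) 𝔄 ι L hL j).gc.Site → Prop)
        (unitDist : ∀ j : VecIndexS d L, (v1VecInstance (d := d) 𝔄 ι L hL j).gc.Site → (v1VecInstance (d := d) 𝔄 ι L hL j).gc.Site → ℝ),
        0 < c35 ∧
        (𝔯.lit F hD.params hD.provisos g₀ os).ne2 k =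
          { I := VecIndexS d L, c35 := c35, p := p, pi := v1VecInstance (d := d) 𝔄 ι L hL, Kop := v1VecFamily4 (d := d) 𝔄 ι e L hL,
            Ksite := Ksite, Kunit := Kunit, inΛ := inΛ, unitDist := unitDist } ∧
        NE2PlusSite 4 p c35 (v1VecInstance (d := d) 𝔄 ι L hL) Ksite ∧ NE2PlusUnit c35 (v1VecInstance (d := d) 𝔄 ι L hL) Kunit inΛ unitDist) :
    S_N15 (RRec₁₂ 𝔯) :=
  s_N15_of_admits_v1 e (fun {F D} (hD : IsDatumOfRecord₁₂C F N D) g₀ os k => (𝔯.lit F hD.params hD.provisos g₀ os).ne2 k)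
    (RRec₁₂ 𝔯) hd hL (admits_rRec₁₂_ne2 𝔯) h

omit [CompleteSpace 𝔄] in
/-- **RR-1's DISPLAY HOLDS AT EVERY `V′₁` LITERAL**: the NE2 objects carrying the `V′₁` family are `Populated` — the sized index `VecIndexS d L` is inhabited
(`VectorPiece.vecIndexS_nonempty`). [bookkeeping] -/
theorem populated_v1Objects (hL : 1 ≤ L) (c35 p : ℝ)
    (Ksite Kunit : ∀ j : VecIndexS d L, B9.SiteKernel (v1VecInstance (d := d) 𝔄 ι L hL j).gc (v1VecInstance (d := d) 𝔄 ι L hL j).Bf)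
    (inΛ : ∀ j : VecIndexS d L, (v1VecInstance (d := d) 𝔄 ι L hL j).gc.Site → Prop)
    (unitDist : ∀ j : VecIndexS d L, (v1VecInstance (d := d) 𝔄 ι L hL j).gc.Site → (v1VecInstance (d := d) 𝔄 ι L hL j).gc.Site → ℝ) :
    ({ I := VecIndexS d L, c35 := c35, p := p, pi := v1VecInstance (d := d) 𝔄 ι L hL, Kop := v1VecFamily4 (d := d) 𝔄 ι e L hL,
        Ksite := Ksite, Kunit := Kunit, inΛ := inΛ, unitDist := unitDist } : NE2Objects₁₁).Populated :=
  (NE2Objects₁₁.populated_iff _).2 (vecIndexS_nonempty d L)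

/-! ## §3 The reading of record, edition 1: N15's residual layer `ne2` read at `V′₁` literals -/

section ReadingOfRecord

variable (w1 : (F : T4Family) → (θ : Stage12Params F N) → ReadingData F (Node00.MatA N) θ.τ9.M) (ℓ₃ : T4Family → NE3Letters₁₁)
  (ne2 : (F : T4Family) → Stage12Params F N → (ℕ → ℝ) → List (ULoop F) → ℕ → NE2Objects₁₁)
  (ne1 : (F : T4Family) → Stage12Params F N → (ℕ → ℝ) → List (ULoop F) → NE1pCarriers)

/-- **N15 AT THE READING OF RECORD (EDITION 1) WITH A `V′₁(A)`-LIVE RESIDUAL LAYER.**  For `d + 1 ≥ 2`, `L ≥ 1`: if N15's residual layer `ne2` of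
dag-n22-e's `readingOfRecord₁₂ w1 ℓ₃ ne2 ne1` takes, at every family, Stage-12 parameter with provisos, `(g₀, os)` and run length, a `V′₁` literal as value
together with the SITE and UNIT layers on it, then the K4 stub `S_N15` holds at the home of the reading of record — the N15 slot of K3′'s rate side
(dag-n27-c's `h15` at `RRec₁₂ (readingOfRecord₁₂ …)`), with the OPERATOR layer by the producer's theorem and exactly the two displayed layers owed.
W1's towers `w1`, the NE3 letters `ℓ₃` and NODE O's `ne1` are idle (component locality). [bookkeeping] -/
theorem s_N15_readingOfRecord₁₂_of_v1 (hd : 1 ≤ d) (hL : 1 ≤ L)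
    (h : ∀ (F : T4Family) (θ : Stage12Params F N), θ.Provisos₁₂ F N → ∀ (g₀ : ℕ → ℝ) (os : List (ULoop F)) (k : ℕ),
      ∃ (c35 p : ℝ) (Ksite Kunit : ∀ j : VecIndexS d L, B9.SiteKernel (v1VecInstance (d := d) 𝔄 ι L hL j).gc (v1VecInstance (d := d) 𝔄 ι L hL j).Bf)
        (inΛ : ∀ j : VecIndexS d L, (v1VecInstance (d := d) 𝔄 ι L hL j).gc.Site → Prop)
        (unitDist : ∀ j : VecIndexS d L, (v1VecInstance (d := d) 𝔄 ι L hL j).gc.Site → (v1VecInstance (d := d) 𝔄 ι L hL j).gc.Site → ℝ),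
        0 < c35 ∧
        ne2 F θ g₀ os k =
          { I := VecIndexS d L, c35 := c35, p := p, pi := v1VecInstance (d := d) 𝔄 ι L hL, Kop := v1VecFamily4 (d := d) 𝔄 ι e L hL,
            Ksite := Ksite, Kunit := Kunit, inΛ := inΛ, unitDist := unitDist } ∧
        NE2PlusSite 4 p c35 (v1VecInstance (d := d) 𝔄 ι L hL) Ksite ∧ NE2PlusUnit c35 (v1VecInstance (d := d) 𝔄 ι L hL) Kunit inΛ unitDist) :
    S_N15 (RRec₁₂ (readingOfRecord₁₂ w1 ℓ₃ ne2 ne1)) :=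
  s_N15_rRec₁₂_of_v1 e hd hL (readingOfRecord₁₂ w1 ℓ₃ ne2 ne1) fun F _ hD g₀ os k => by
    rw [readingOfRecord₁₂_ne2]
    exact h F hD.params hD.provisos g₀ os k

omit [CompleteSpace 𝔄] in
/-- **SUCH A READING OF RECORD IS POPULATED** (RR-1's display, all three thirds): if the residual layer `ne2` takes `V′₁` literals as values at every run length,
the reading of record is `Populated` at every Stage-12 parameter with provisos (dag-n22-e's `readingOfRecord₁₂_populated_iff`: W1's U3 layer and RR-1's constant NE3
layer are populated unconditionally; the last third is `populated_v1Objects`). [bookkeeping] -/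
theorem populated_readingOfRecord₁₂_of_v1 (hL : 1 ≤ L) (F : T4Family) (θ : Stage12Params F N) (hP : θ.Provisos₁₂ F N) (g₀ : ℕ → ℝ)
    (os : List (ULoop F))
    (h : ∀ k : ℕ, ∃ (c35 p : ℝ)
        (Ksite Kunit : ∀ j : VecIndexS d L, B9.SiteKernel (v1VecInstance (d := d) 𝔄 ι L hL j).gc (v1VecInstance (d := d) 𝔄 ι L hL j).Bf)
        (inΛ : ∀ j : VecIndexS d L, (v1VecInstance (d := d) 𝔄 ι L hL j).gc.Site → Prop)
        (unitDist : ∀ j : VecIndexS d L, (v1VecInstance (d := d) 𝔄 ι L hL j).gc.Site → (v1VecInstance (d := d) 𝔄 ι L hL j).gc.Site → ℝ),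
        ne2 F θ g₀ os k =
          { I := VecIndexS d L, c35 := c35, p := p, pi := v1VecInstance (d := d) 𝔄 ι L hL, Kop := v1VecFamily4 (d := d) 𝔄 ι e L hL,
            Ksite := Ksite, Kunit := Kunit, inΛ := inΛ, unitDist := unitDist }) :
    ((readingOfRecord₁₂ w1 ℓ₃ ne2 ne1).lit F θ hP g₀ os).Populated := by
  refine (readingOfRecord₁₂_populated_iff w1 ℓ₃ ne2 ne1 F θ hP g₀ os).2 fun k => ?_
  obtain ⟨c35, p, Ksite, Kunit, inΛ, unitDist, hk⟩ := h k
  rw [hk]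
  exact populated_v1Objects e hL c35 p Ksite Kunit inΛ unitDist

end ReadingOfRecord

/-! ### The constant residual layer at one `V′₁` literal -/

section Const

variable (w1 : (F : T4Family) → (θ : Stage12Params F N) → ReadingData F (Node00.MatA N) θ.τ9.M) (ℓ₃ : T4Family → NE3Letters₁₁)
  (ne1 : (F : T4Family) → Stage12Params F N → (ℕ → ℝ) → List (ULoop F) → NE1pCarriers)

/-- **THE CONSTANT `V′₁` RESIDUAL LAYER CLOSES N15's SLOT AT THE READING OF RECORD MODULO THE TWO DISPLAYED LAYERS** [decided toy, non-degenerate]: with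
`ne2 := fun _ _ _ _ _ => o`, `o` the `V′₁` literal at letters `(c35 > 0, p)` and site ∕ unit kernels `Ksite`, `Kunit`, region `inΛ`, unit distance `unitDist`,
the stub `S_N15 (RRec₁₂ (readingOfRecord₁₂ w1 ℓ₃ ne2 ne1))` follows from the SITE and UNIT layers on the `V′₁` carriers ALONE — the operator layer with
the background LIVE is dag-n15-c's theorem.  A MODEL-level reading NAMED here, not NODE 00's objects of record. [bookkeeping] -/
theorem s_N15_readingOfRecord₁₂_v1Const (hd : 1 ≤ d) (hL : 1 ≤ L) {c35 : ℝ} (hc35 : 0 < c35) (p : ℝ)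
    (Ksite Kunit : ∀ j : VecIndexS d L, B9.SiteKernel (v1VecInstance (d := d) 𝔄 ι L hL j).gc (v1VecInstance (d := d) 𝔄 ι L hL j).Bf)
    (inΛ : ∀ j : VecIndexS d L, (v1VecInstance (d := d) 𝔄 ι L hL j).gc.Site → Prop)
    (unitDist : ∀ j : VecIndexS d L, (v1VecInstance (d := d) 𝔄 ι L hL j).gc.Site → (v1VecInstance (d := d) 𝔄 ι L hL j).gc.Site → ℝ)
    (hsite : NE2PlusSite 4 p c35 (v1VecInstance (d := d) 𝔄 ι L hL) Ksite)
    (hunit : NE2PlusUnit c35 (v1VecInstance (d := d) 𝔄 ι L hL) Kunit inΛ unitDist) :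
    S_N15 (RRec₁₂ (readingOfRecord₁₂ w1 ℓ₃
      (fun _ _ _ _ _ =>
        { I := VecIndexS d L, c35 := c35, p := p, pi := v1VecInstance (d := d) 𝔄 ι L hL, Kop := v1VecFamily4 (d := d) 𝔄 ι e L hL,
          Ksite := Ksite, Kunit := Kunit, inΛ := inΛ, unitDist := unitDist }) ne1)) :=
  s_N15_readingOfRecord₁₂_of_v1 e w1 ℓ₃ _ ne1 hd hL fun _ _ _ _ _ _ =>
    ⟨c35, p, Ksite, Kunit, inΛ, unitDist, hc35, rfl, hsite, hunit⟩

omit [CompleteSpace 𝔄] in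
/-- **… AND THAT READING OF RECORD IS POPULATED EVERYWHERE** (RR-1's display met at every Stage-12 parameter with provisos). [bookkeeping] -/
theorem populated_readingOfRecord₁₂_v1Const (hL : 1 ≤ L) (c35 p : ℝ)
    (Ksite Kunit : ∀ j : VecIndexS d L, B9.SiteKernel (v1VecInstance (d := d) 𝔄 ι L hL j).gc (v1VecInstance (d := d) 𝔄 ι L hL j).Bf)
    (inΛ : ∀ j : VecIndexS d L, (v1VecInstance (d := d) 𝔄 ι L hL j).gc.Site → Prop)
    (unitDist : ∀ j : VecIndexS d L, (v1VecInstance (d := d) 𝔄 ι L hL j).gc.Site → (v1VecInstance (d := d) 𝔄 ι L hL j).gc.Site → ℝ)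
    (F : T4Family) (θ : Stage12Params F N) (hP : θ.Provisos₁₂ F N) (g₀ : ℕ → ℝ) (os : List (ULoop F)) :
    ((readingOfRecord₁₂ w1 ℓ₃
      (fun _ _ _ _ _ =>
        { I := VecIndexS d L, c35 := c35, p := p, pi := v1VecInstance (d := d) 𝔄 ι L hL, Kop := v1VecFamily4 (d := d) 𝔄 ι e L hL,
          Ksite := Ksite, Kunit := Kunit, inΛ := inΛ, unitDist := unitDist }) ne1).lit F θ hP g₀ os).Populated :=
  populated_readingOfRecord₁₂_of_v1 e w1 ℓ₃ _ ne1 hL F θ hP g₀ os fun _ => ⟨c35, p, Ksite, Kunit, inΛ, unitDist, rfl⟩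

end Const

/-! ## §4 The gauge-field-as-datum family `V′₁(A′)` (dag-n15-c (V4)): the same faces -/

section Gauge

variable {key : (F : T4Family) → Datum F N → Prop}
  (ne2At : ∀ {F : T4Family} {D : Datum F N}, key F D → (ℕ → ℝ) → List (ULoop F) → ℕ → NE2Objects₁₁)
  (RRec : RateRecordPred N)

/-- **THE `V′₁(A′)`-LIVE OPERATOR LAYER (GAUGE FIELD AS THE DATUM) AT ANY KEYED HOME.**  As `s_N15_of_admits_v1`, for dag-n15-c's family over the C²-letter
gauge carriers — paired instances `VectorPiece.v1GVecInstance 𝔄 ι L hL` (configurations = ONE `𝔄`-valued gauge field `A′`; (3.35) = sup, first and second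
differences at the unit scale, guard LIVE), operator kernels `VectorPiece.v1GVecFamily4 𝔄 ι e L hL` (V2's pair at the derived triple `(A′, A′∘s′⁻¹, Σ_μ η′⁻¹(A′_μ − A′_μ∘s′_μ⁻¹))`):
the literals with the SITE and UNIT layers ⇒ `S_N15 RRec`, the operator conjunct being `VectorPiece.ne2PlusOperator_vectorPiece_v1G` (through
`N15AtSpineCarriers.s_N15_of_v1GReading RRec`), NOT a hypothesis. [bookkeeping] -/
theorem s_N15_of_admits_v1G (hd : 1 ≤ d) (hL : 1 ≤ L)
    (hadm : ∀ (F : T4Family) (D : Datum F N) (g₀ : ℕ → ℝ) (os : List (ULoop F)) (R : RateCarriers N), RRec F D g₀ os R →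
      ∃ (h : key F D) (k : ℕ), R.ne2 = ne2OfRecord₁₁ (ne2At h g₀ os k))
    (h : ∀ (F : T4Family) (D : Datum F N) (hk : key F D) (g₀ : ℕ → ℝ) (os : List (ULoop F)) (k : ℕ),
      ∃ (c35 p : ℝ) (Ksite Kunit : ∀ j : VecIndexS d L, B9.SiteKernel (v1GVecInstance (d := d) 𝔄 ι L hL j).gc (v1GVecInstance (d := d) 𝔄 ι L hL j).Bf)
        (inΛ : ∀ j : VecIndexS d L, (v1GVecInstance (d := d) 𝔄 ι L hL j).gc.Site → Prop)
        (unitDist : ∀ j : VecIndexS d L, (v1GVecInstance (d := d) 𝔄 ι L hL j).gc.Site → (v1GVecInstance (d := d) 𝔄 ι L hL j).gc.Site → ℝ),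
        0 < c35 ∧
        ne2At hk g₀ os k =
          { I := VecIndexS d L, c35 := c35, p := p, pi := v1GVecInstance (d := d) 𝔄 ι L hL, Kop := v1GVecFamily4 (d := d) 𝔄 ι e L hL,
            Ksite := Ksite, Kunit := Kunit, inΛ := inΛ, unitDist := unitDist } ∧
        NE2PlusSite 4 p c35 (v1GVecInstance (d := d) 𝔄 ι L hL) Ksite ∧ NE2PlusUnit c35 (v1GVecInstance (d := d) 𝔄 ι L hL) Kunit inΛ unitDist) :
    S_N15 RRec := by
  refine s_N15_of_v1GReading e hd hL RRec ?_
  intro F D g₀ os R hR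
  obtain ⟨hk, k, hne2⟩ := hadm F D g₀ os R hR
  obtain ⟨c35, p, Ksite, Kunit, inΛ, unitDist, hc35, hlit, hsite, hunit⟩ := h F D hk g₀ os k
  refine ⟨c35, p, Ksite, Kunit, inΛ, unitDist, hc35, ?_, hsite, hunit⟩
  rw [hne2, hlit]
  rfl

end Gauge

/-- **THE `V′₁(A′)`-LIVE OPERATOR LAYER AT THE STAGE-12 HOME** (§4's `s_N15_of_admits_v1G` at the certificate `AtRateRecord12.admits_rRec₁₂_ne2`). [bookkeeping] -/
theorem s_N15_rRec₁₂_of_v1G (hd : 1 ≤ d) (hL : 1 ≤ L) (𝔯 : RateReading₁₂ N)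
    (h : ∀ (F : T4Family) (D : Datum F N) (hD : IsDatumOfRecord₁₂C F N D) (g₀ : ℕ → ℝ) (os : List (ULoop F)) (k : ℕ),
      ∃ (c35 p : ℝ) (Ksite Kunit : ∀ j : VecIndexS d L, B9.SiteKernel (v1GVecInstance (d := d) 𝔄 ι L hL j).gc (v1GVecInstance (d := d) 𝔄 ι L hL j).Bf)
        (inΛ : ∀ j : VecIndexS d L, (v1GVecInstance (d := d) 𝔄 ι L hL j).gc.Site → Prop)
        (unitDist : ∀ j : VecIndexS d L, (v1GVecInstance (d := d) 𝔄 ι L hL j).gc.Site → (v1GVecInstance (d := d) 𝔄 ι L hL j).gc.Site → ℝ),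
        0 < c35 ∧
        (𝔯.lit F hD.params hD.provisos g₀ os).ne2 k =
          { I := VecIndexS d L, c35 := c35, p := p, pi := v1GVecInstance (d := d) 𝔄 ι L hL, Kop := v1GVecFamily4 (d := d) 𝔄 ι e L hL,
            Ksite := Ksite, Kunit := Kunit, inΛ := inΛ, unitDist := unitDist } ∧
        NE2PlusSite 4 p c35 (v1GVecInstance (d := d) 𝔄 ι L hL) Ksite ∧ NE2PlusUnit c35 (v1GVecInstance (d := d) 𝔄 ι L hL) Kunit inΛ unitDist) :
    S_N15 (RRec₁₂ 𝔯) :=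
  s_N15_of_admits_v1G e (fun {F D} (hD : IsDatumOfRecord₁₂C F N D) g₀ os k => (𝔯.lit F hD.params hD.provisos g₀ os).ne2 k)
    (RRec₁₂ 𝔯) hd hL (admits_rRec₁₂_ne2 𝔯) h

omit [CompleteSpace 𝔄] in
/-- **RR-1's DISPLAY HOLDS AT EVERY `V′₁(A′)` LITERAL** (`VectorPiece.vecIndexS_nonempty`). [bookkeeping] -/
theorem populated_v1GObjects (hL : 1 ≤ L) (c35 p : ℝ)
    (Ksite Kunit : ∀ j : VecIndexS d L, B9.SiteKernel (v1GVecInstance (d := d) 𝔄 ι L hL j).gc (v1GVecInstance (d := d) 𝔄 ι L hL j).Bf)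
    (inΛ : ∀ j : VecIndexS d L, (v1GVecInstance (d := d) 𝔄 ι L hL j).gc.Site → Prop)
    (unitDist : ∀ j : VecIndexS d L, (v1GVecInstance (d := d) 𝔄 ι L hL j).gc.Site → (v1GVecInstance (d := d) 𝔄 ι L hL j).gc.Site → ℝ) :
    ({ I := VecIndexS d L, c35 := c35, p := p, pi := v1GVecInstance (d := d) 𝔄 ι L hL, Kop := v1GVecFamily4 (d := d) 𝔄 ι e L hL,
        Ksite := Ksite, Kunit := Kunit, inΛ := inΛ, unitDist := unitDist } : NE2Objects₁₁).Populated :=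
  (NE2Objects₁₁.populated_iff _).2 (vecIndexS_nonempty d L)

section GaugeReadingOfRecord

variable (w1 : (F : T4Family) → (θ : Stage12Params F N) → ReadingData F (Node00.MatA N) θ.τ9.M) (ℓ₃ : T4Family → NE3Letters₁₁)
  (ne2 : (F : T4Family) → Stage12Params F N → (ℕ → ℝ) → List (ULoop F) → ℕ → NE2Objects₁₁)
  (ne1 : (F : T4Family) → Stage12Params F N → (ℕ → ℝ) → List (ULoop F) → NE1pCarriers)

/-- **N15 AT THE READING OF RECORD (EDITION 1) WITH A `V′₁(A′)`-LIVE RESIDUAL LAYER** (§3's `s_N15_readingOfRecord₁₂_of_v1` for the gauge-field-as-datum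
family): every residual layer `ne2` valued in `V′₁(A′)` literals carrying the two displayed layers closes `S_N15 (RRec₁₂ (readingOfRecord₁₂ w1 ℓ₃ ne2 ne1))`,
operator third by the producer's theorem. [bookkeeping] -/
theorem s_N15_readingOfRecord₁₂_of_v1G (hd : 1 ≤ d) (hL : 1 ≤ L)
    (h : ∀ (F : T4Family) (θ : Stage12Params F N), θ.Provisos₁₂ F N → ∀ (g₀ : ℕ → ℝ) (os : List (ULoop F)) (k : ℕ),
      ∃ (c35 p : ℝ) (Ksite Kunit : ∀ j : VecIndexS d L, B9.SiteKernel (v1GVecInstance (d := d) 𝔄 ι L hL j).gc (v1GVecInstance (d := d) 𝔄 ι L hL j).Bf)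
        (inΛ : ∀ j : VecIndexS d L, (v1GVecInstance (d := d) 𝔄 ι L hL j).gc.Site → Prop)
        (unitDist : ∀ j : VecIndexS d L, (v1GVecInstance (d := d) 𝔄 ι L hL j).gc.Site → (v1GVecInstance (d := d) 𝔄 ι L hL j).gc.Site → ℝ),
        0 < c35 ∧
        ne2 F θ g₀ os k =
          { I := VecIndexS d L, c35 := c35, p := p, pi := v1GVecInstance (d := d) 𝔄 ι L hL, Kop := v1GVecFamily4 (d := d) 𝔄 ι e L hL,
            Ksite := Ksite, Kunit := Kunit, inΛ := inΛ, unitDist := unitDist } ∧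
        NE2PlusSite 4 p c35 (v1GVecInstance (d := d) 𝔄 ι L hL) Ksite ∧ NE2PlusUnit c35 (v1GVecInstance (d := d) 𝔄 ι L hL) Kunit inΛ unitDist) :
    S_N15 (RRec₁₂ (readingOfRecord₁₂ w1 ℓ₃ ne2 ne1)) :=
  s_N15_rRec₁₂_of_v1G e hd hL (readingOfRecord₁₂ w1 ℓ₃ ne2 ne1) fun F _ hD g₀ os k => by
    rw [readingOfRecord₁₂_ne2]
    exact h F hD.params hD.provisos g₀ os k

end GaugeReadingOfRecord

section GaugeConst

variable (w1 : (F : T4Family) → (θ : Stage12Params F N) → ReadingData F (Node00.MatA N) θ.τ9.M) (ℓ₃ : T4Family → NE3Letters₁₁)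
  (ne1 : (F : T4Family) → Stage12Params F N → (ℕ → ℝ) → List (ULoop F) → NE1pCarriers)

/-- **THE CONSTANT `V′₁(A′)` RESIDUAL LAYER CLOSES N15's SLOT AT THE READING OF RECORD MODULO THE TWO DISPLAYED LAYERS** [decided toy, non-degenerate]
(§3's `s_N15_readingOfRecord₁₂_v1Const` for the gauge-field-as-datum family). [bookkeeping] -/
theorem s_N15_readingOfRecord₁₂_v1GConst (hd : 1 ≤ d) (hL : 1 ≤ L) {c35 : ℝ} (hc35 : 0 < c35) (p : ℝ)
    (Ksite Kunit : ∀ j : VecIndexS d L, B9.SiteKernel (v1GVecInstance (d := d) 𝔄 ι L hL j).gc (v1GVecInstance (d := d) 𝔄 ι L hL j).Bf)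
    (inΛ : ∀ j : VecIndexS d L, (v1GVecInstance (d := d) 𝔄 ι L hL j).gc.Site → Prop)
    (unitDist : ∀ j : VecIndexS d L, (v1GVecInstance (d := d) 𝔄 ι L hL j).gc.Site → (v1GVecInstance (d := d) 𝔄 ι L hL j).gc.Site → ℝ)
    (hsite : NE2PlusSite 4 p c35 (v1GVecInstance (d := d) 𝔄 ι L hL) Ksite)
    (hunit : NE2PlusUnit c35 (v1GVecInstance (d := d) 𝔄 ι L hL) Kunit inΛ unitDist) :
    S_N15 (RRec₁₂ (readingOfRecord₁₂ w1 ℓ₃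
      (fun _ _ _ _ _ =>
        { I := VecIndexS d L, c35 := c35, p := p, pi := v1GVecInstance (d := d) 𝔄 ι L hL, Kop := v1GVecFamily4 (d := d) 𝔄 ι e L hL,
          Ksite := Ksite, Kunit := Kunit, inΛ := inΛ, unitDist := unitDist }) ne1)) :=
  s_N15_readingOfRecord₁₂_of_v1G e w1 ℓ₃ _ ne1 hd hL fun _ _ _ _ _ _ =>
    ⟨c35, p, Ksite, Kunit, inΛ, unitDist, hc35, rfl, hsite, hunit⟩

omit [CompleteSpace 𝔄] in
/-- **… AND THAT READING OF RECORD IS POPULATED EVERYWHERE** (n22-e's `readingOfRecord₁₂_populated_iff` with `populated_v1GObjects`). [bookkeeping] -/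
theorem populated_readingOfRecord₁₂_v1GConst (hL : 1 ≤ L) (c35 p : ℝ)
    (Ksite Kunit : ∀ j : VecIndexS d L, B9.SiteKernel (v1GVecInstance (d := d) 𝔄 ι L hL j).gc (v1GVecInstance (d := d) 𝔄 ι L hL j).Bf)
    (inΛ : ∀ j : VecIndexS d L, (v1GVecInstance (d := d) 𝔄 ι L hL j).gc.Site → Prop)
    (unitDist : ∀ j : VecIndexS d L, (v1GVecInstance (d := d) 𝔄 ι L hL j).gc.Site → (v1GVecInstance (d := d) 𝔄 ι L hL j).gc.Site → ℝ)
    (F : T4Family) (θ : Stage12Params F N) (hP : θ.Provisos₁₂ F N) (g₀ : ℕ → ℝ) (os : List (ULoop F)) :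
    ((readingOfRecord₁₂ w1 ℓ₃
      (fun _ _ _ _ _ =>
        { I := VecIndexS d L, c35 := c35, p := p, pi := v1GVecInstance (d := d) 𝔄 ι L hL, Kop := v1GVecFamily4 (d := d) 𝔄 ι e L hL,
          Ksite := Ksite, Kunit := Kunit, inΛ := inΛ, unitDist := unitDist }) ne1).lit F θ hP g₀ os).Populated :=
  (readingOfRecord₁₂_populated_iff w1 ℓ₃ _ ne1 F θ hP g₀ os).2 fun _ => populated_v1GObjects e hL c35 p Ksite Kunit inΛ unitDist

end GaugeConst

end Summit.QuantumFields.YangMills.BalabanUVNodes.N15.AtRateRecord12V1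

end
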